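import Summits.Ventures.CertifiedArithmetic.Expansions.Orient2dBlocks
import Mathlib.Tactic.Linarith
import Mathlib.Tactic.Positivity
import Mathlib.Tactic.Ring
import Mathlib.Tactic.NormNum

/-!
# The exact stage of ORIENT2D in weakly nonoverlapping expansion arithmetic (Theorems 6 and 7)

New work of this development (no published counterpart is claimed; see the presearch note at the
end).  Files `WeakExpansion*.lean` of this directory introduced the class `W` of WEAKLY
NONOVERLAPPING expansions (`IsWeakExpansion`) and proved it closed under GROW-EXPANSION,
EXPANSION-SUM (Theorem 5, `expansionSum_isWeakExpansion`, any `p ≥ 1`) and FAST-EXPANSION-SUM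
(Theorems 1–2, `fastExpansionSum_isWeakExpansion` / `_nonoverlapping_of_isWeakExpansion`, `p ≥ 4`)
under any round-to-nearest whose roundoff lies 2-below its result (`RoundoffBelow 2`, e.g. IEEE 754
round-half-even) — "the composability the adaptive predicates need".  This file cashes that in on
the flagship client, the exact (last) stage of Shewchuk's two-dimensional orientation test
[Shewchuk1997, §4.3 p. 346–347, Fig. 21: "The exact result D may be as long as 16 components, but
zero elimination is used"], with the block structure of the public-domain `predicates.c`
(`orient2dadapt`, final part):
```
  acx, acxtail ⇐ TWO-DIFF(a₁, c₁)   acy, acytail ⇐ TWO-DIFF(a₂, c₂)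
  bcx, bcxtail ⇐ TWO-DIFF(b₁, c₁)   bcy, bcytail ⇐ TWO-DIFF(b₂, c₂)
  B  ⇐ TWO-TWO-DIFF(TWO-PRODUCT(acx, bcy), TWO-PRODUCT(acy, bcx))            -- 4 components
  u₁ ⇐ TWO-TWO-DIFF(TWO-PRODUCT(acxtail, bcy), TWO-PRODUCT(acytail, bcx));   C₁ ⇐ FESZE(B, u₁)
  u₂ ⇐ TWO-TWO-DIFF(TWO-PRODUCT(acx, bcytail), TWO-PRODUCT(acy, bcxtail));   C₂ ⇐ FESZE(C₁, u₂)
  u₃ ⇐ TWO-TWO-DIFF(TWO-PRODUCT(acxtail, bcytail), TWO-PRODUCT(acytail, bcxtail)); D ⇐ FESZE(C₂, u₃)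
  return sign(D[last])
```
(FESZE = FAST-EXPANSION-SUM with zero elimination, `fast_expansion_sum_zeroelim`.)

WHAT IS PROVED (`p ≥ 4`, any `IsRoundNearest p emin fl` with `fl (−t) = −fl t` and `RoundoffBelow 2 fl`
— e.g. `roundTiesEven` — and any two-product routine `tp` that is error-free on the operands, see
`ExactTwoProd`; the six input coordinates are floats of a format `F(p, e₀)`, `e₀ ≥ emin`, i.e. `p`-bit
multiples of `2^e₀` — `e₀ = emin` is allowed when `tp` is exact there):
* (in `Orient2dBlocks.lean`) `twoTwoProdDiff_spec`: each block `(a ⊗ b, its tail) ⊖⊖ (c ⊗ d, its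
  tail)` is a 4-component W-expansion of floats summing to `ab − cd` EXACTLY (TWO-TWO-DIFF is
  EXPANSION-SUM of the pair and the negated pair, `twoTwoDiff`; `twoTwoDiffMacro_eq` checks that
  `predicates.c`'s macro `Two_Two_Diff` — two `Two_One_Diff`s built from `Two_Diff`/`Two_Sum` —
  computes the same four numbers on floats); `fastExpansionSumZeroElim_spec`: FESZE maps W-expansions
  of floats to NONEMPTY W-expansions of floats with the exact sum whose components are all nonzero,
  unless the result is the one-component `⟨0⟩`.
* **THEOREM 6** (`orient2dExact_spec`): `D` is a weakly nonoverlapping (hence nonoverlapping,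
  increasing) expansion of at most 16 floats, zero-free or equal to `⟨0⟩`, with
  `Σ D = (a₁ − c₁)(b₂ − c₂) − (a₂ − c₂)(b₁ − c₁)` EXACTLY.
* **THEOREM 7** (`orient2dExact_sign`): the returned sign is the sign of the determinant —
  `det > 0 ↔ D[last] > 0`, `det < 0 ↔ D[last] < 0`, `det = 0 ↔ D = ⟨0⟩` (Shewchuk's §2.8 sign test,
  `sign_sum_of_getLast_ne_zero`).
* Instances: `exactTwoProd_twoProdFMA` (the FMA two-product is exact on `F(p, e₀)²` as soon as
  `2e₀ ≥ emin`), `exactTwoProd_twoProduct` (Dekker's TWO-PRODUCT, Shewchuk's Theorem 18 as formalised in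
  `ScaleExpansion.lean`, on `F(p, e₀)²` when `e₀ ≥ emin + p − 1` and `2e₀ ≥ emin + 2p − 1`), and the
  headline `orient2dRNE_correct`: on a round-to-nearest-even machine with an FMA two-product, for all
  input coordinates in `F(p, e₀)` with `emin ≤ e₀`, `emin ≤ 2e₀` (binary64: all coordinates multiples of
  `2^−537`), ORIENT2D's exact stage returns the sign of the orientation determinant.

MODELLING CAVEATS (honest scope).  (1) Zero elimination is modelled as a post-pass `zeroElim` on the
output of the tree's `fastExpansionSum`; `fast_expansion_sum_zeroelim` interleaves it with the loop
but stores exactly the same numbers (the `hh ≠ 0` outputs, then `Q` if `Q ≠ 0` or nothing was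
stored).  (2) The tree's `mergeExpansions` merges by `|·|` taking the `e`-component first on ties;
`predicates.c`'s test `(fnow > enow) == (fnow > -enow)` may order components of EQUAL magnitude
differently, so on such inputs the C code may produce a different (equally valid per Theorem 13)
component list — the theorems below are about the tree's merge order.  (3) TWO-DIFF is reduced to
TWO-SUM(a, −b) and therefore needs a rounding commuting with negation (`TwoDiff.lean`); overflow is not
modelled (unbounded exponents above), underflow is (gradual), whence the format hypothesis `F(p, e₀)`
making the two-products exact.  (4) Stages A–C of Fig. 21 (the floating-point filter and its error
bounds) are not treated here; this is the exact fallback only.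

EVIDENCE BEFORE PROOF: an exact rational model of this very pipeline (round-half-even, FMA
two-product) was run on random inputs — p = 6, 8, 11, 24 with 3000/3000/2000/1500 cases — with zero
violations of W-membership (all intermediate lists), exactness, the sign test and the zero test, and
20000 random TWO-TWO-DIFF blocks (p = 6) agreeing with the macro form.

PRESEARCH (nearest formal prior art found; none proves this): Boldo–Joldes–Muller–Popescu, *Formal
verification of a floating-point expansion renormalization algorithm*, ITP 2017
[corpus: book:ayala-rincon2017-interactive-theorem-proving, pp. 111–123] — Coq, renormalisation of
expansions only; Melquiond–Pion, *Formally certified floating-point filters for homogeneous geometric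
predicates*, Theor. Inform. Appl. 41 (2007) 57–69, doi:10.1051/ita:2007005 (cited
[corpus: book:boldond-computer-arithmetic-formal-proofs, p. 299]) — the floating-point FILTER stages
(Gappa/Coq), not the exact stage; Dufourd–Bertot, *Formal study of plane Delaunay triangulation*
[corpus: paper:arxiv-1007.3350] — orientation predicates axiomatised over an abstract ordered field.  No
machine-checked account of the exact stage of ORIENT2D in expansion arithmetic was found (corpus
full-text + hybrid + vector search and galaxy substring search on "orientation predicate | orient2d |
expansion arithmetic | nonoverlapping expansion", 2026-08-23).
-/

namespace Summit.Ventures.CertifiedArithmetic.Expansions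

open Literature.ComputerArithmetic.JeannerodRump2018
open Literature.ComputerArithmetic.BoldoJeannerodMelquiondMuller2023 hiding twoSum twoSum_fst isFloat_twoSum
open Literature.ComputerArithmetic.Shewchuk1997

variable {p : ℕ} {emin : ℤ} {fl : ℚ → ℚ}

/-! ## ORIENT2D, exact stage -/

/-- TWO-DIFF on inputs of a coarser format `F(p, e₀)` (`p`-bit multiples of `2^e₀`, `e₀ ≥ emin`): both
outputs are again in `F(p, e₀)` (rounding and exact subtraction stay on the grid `2^e₀·ℤ`) and they
sum to `a − b` exactly. -/
theorem twoDiff_coarse (hp : 1 ≤ p) (hfl : IsRoundNearest p emin fl) (hodd : ∀ t, fl (-t) = -fl t)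
    {e₀ : ℤ} (he₀ : emin ≤ e₀) {a b : ℚ} (ha : IsFloat p e₀ a) (hb : IsFloat p e₀ b) :
    IsFloat p e₀ (twoDiff fl a b).1 ∧ IsFloat p e₀ (twoDiff fl a b).2 ∧
      (twoDiff fl a b).1 + (twoDiff fl a b).2 = a - b := by
  obtain ⟨h1, h2, hs⟩ := twoDiff_exact hp hfl hodd (isFloat_of_emin_le he₀ ha)
    (isFloat_of_emin_le he₀ hb)
  have hg : OnGrid e₀ (a - b) := (OnGrid.of_isFloat ha).sub (OnGrid.of_isFloat hb)
  have hg1 : OnGrid e₀ (twoDiff fl a b).1 := by rw [h1]; exact hg.fl_of hp hfl he₀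
  have hg2 : OnGrid e₀ (twoDiff fl a b).2 := by rw [h2]; exact hg.sub (hg.fl_of hp hfl he₀)
  exact ⟨isFloat_of_isFloat_of_onGrid (isFloat_twoDiff hfl a b).1 hg1,
    isFloat_of_isFloat_of_onGrid (isFloat_twoDiff hfl a b).2 hg2, hs⟩

/-- The two-dimensional orientation determinant `|a₁−c₁  a₂−c₂; b₁−c₁  b₂−c₂|` (positive iff
`a, b, c` occur counterclockwise) [Shewchuk1997, §4.1]. -/
def orient2dDet (a₁ a₂ b₁ b₂ c₁ c₂ : ℚ) : ℚ := (a₁ - c₁) * (b₂ - c₂) - (a₂ - c₂) * (b₁ - c₁)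

/-- **THE EXACT STAGE OF ORIENT2D** (Fig. 21, result `D`; `predicates.c` `orient2dadapt`, final
part), over a two-product routine `tp` and a rounding `fl`; see the module docstring for the block
structure.  Returns the zero-eliminated expansion `D` (the C code returns `D[Dlength − 1]`). -/
def orient2dExact (tp : ℚ → ℚ → ℚ × ℚ) (fl : ℚ → ℚ) (a₁ a₂ b₁ b₂ c₁ c₂ : ℚ) : List ℚ :=
  let acx := (twoDiff fl a₁ c₁).1
  let acxtail := (twoDiff fl a₁ c₁).2
  let acy := (twoDiff fl a₂ c₂).1
  let acytail := (twoDiff fl a₂ c₂).2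
  let bcx := (twoDiff fl b₁ c₁).1
  let bcxtail := (twoDiff fl b₁ c₁).2
  let bcy := (twoDiff fl b₂ c₂).1
  let bcytail := (twoDiff fl b₂ c₂).2
  let B := twoTwoProdDiff tp fl acx bcy acy bcx
  let C₁ := fastExpansionSumZeroElim fl B (twoTwoProdDiff tp fl acxtail bcy acytail bcx)
  let C₂ := fastExpansionSumZeroElim fl C₁ (twoTwoProdDiff tp fl acx bcytail acy bcxtail)
  fastExpansionSumZeroElim fl C₂ (twoTwoProdDiff tp fl acxtail bcytail acytail bcxtail)

/-- **THEOREM 6 (ORIENT2D's exact stage is an exact W-expansion).**  Let `p ≥ 4`, `fl` a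
round-to-nearest commuting with negation whose roundoff lies 2-below its result (e.g. round-half-even),
`tp` a two-product error-free on `F(p, e₀)²`, `emin ≤ e₀`, and let the six coordinates be in `F(p, e₀)`.
Then `D = orient2dExact tp fl …` is a weakly nonoverlapping expansion (so nonoverlapping and increasing,
`IsWeakExpansion.isExpansion`) of at most 16 floats, nonempty, all of whose components are nonzero unless
`D = ⟨0⟩`, and `Σ D = (a₁ − c₁)(b₂ − c₂) − (a₂ − c₂)(b₁ − c₁)` EXACTLY. -/
theorem orient2dExact_spec (hp : 4 ≤ p) (hfl : IsRoundNearest p emin fl)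
    (hodd : ∀ t, fl (-t) = -fl t) (hfl2 : RoundoffBelow 2 fl) {e₀ : ℤ} (he₀ : emin ≤ e₀)
    {tp : ℚ → ℚ → ℚ × ℚ}
    (htp : ∀ x y, IsFloat p e₀ x → IsFloat p e₀ y → ExactTwoProd p emin fl tp x y)
    {a₁ a₂ b₁ b₂ c₁ c₂ : ℚ} (ha₁ : IsFloat p e₀ a₁) (ha₂ : IsFloat p e₀ a₂) (hb₁ : IsFloat p e₀ b₁)
    (hb₂ : IsFloat p e₀ b₂) (hc₁ : IsFloat p e₀ c₁) (hc₂ : IsFloat p e₀ c₂) :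
    IsWeakExpansion (orient2dExact tp fl a₁ a₂ b₁ b₂ c₁ c₂) ∧
      (orient2dExact tp fl a₁ a₂ b₁ b₂ c₁ c₂).sum = orient2dDet a₁ a₂ b₁ b₂ c₁ c₂ ∧
      (∀ x ∈ orient2dExact tp fl a₁ a₂ b₁ b₂ c₁ c₂, IsFloat p emin x) ∧
      orient2dExact tp fl a₁ a₂ b₁ b₂ c₁ c₂ ≠ [] ∧
      ((∀ x ∈ orient2dExact tp fl a₁ a₂ b₁ b₂ c₁ c₂, x ≠ 0) ∨
        orient2dExact tp fl a₁ a₂ b₁ b₂ c₁ c₂ = [0]) ∧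
      (orient2dExact tp fl a₁ a₂ b₁ b₂ c₁ c₂).length ≤ 16 := by
  have hp1 : 1 ≤ p := le_trans (by norm_num) hp
  obtain ⟨fxa, fxat, sxa⟩ := twoDiff_coarse hp1 hfl hodd he₀ ha₁ hc₁
  obtain ⟨fya, fyat, sya⟩ := twoDiff_coarse hp1 hfl hodd he₀ ha₂ hc₂
  obtain ⟨fxb, fxbt, sxb⟩ := twoDiff_coarse hp1 hfl hodd he₀ hb₁ hc₁
  obtain ⟨fyb, fybt, syb⟩ := twoDiff_coarse hp1 hfl hodd he₀ hb₂ hc₂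
  -- the four blocks `B, u₁, u₂, u₃`
  obtain ⟨WB, SB, LB, FB⟩ := twoTwoProdDiff_spec hp1 hfl hfl2 (htp _ _ fxa fyb) (htp _ _ fya fxb)
  obtain ⟨W1, S1, L1, F1⟩ := twoTwoProdDiff_spec hp1 hfl hfl2 (htp _ _ fxat fyb) (htp _ _ fyat fxb)
  obtain ⟨W2, S2, L2, F2⟩ := twoTwoProdDiff_spec hp1 hfl hfl2 (htp _ _ fxa fybt) (htp _ _ fya fxbt)
  obtain ⟨W3, S3, L3, F3⟩ :=
    twoTwoProdDiff_spec hp1 hfl hfl2 (htp _ _ fxat fybt) (htp _ _ fyat fxbt)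
  -- the three zero-eliminated fast expansion sums `C₁, C₂, D`
  obtain ⟨WC1, SC1, FC1, -, -, LC1⟩ := fastExpansionSumZeroElim_spec hp hfl hfl2 FB WB F1 W1
  obtain ⟨WC2, SC2, FC2, -, -, LC2⟩ := fastExpansionSumZeroElim_spec hp hfl hfl2 FC1 WC1 F2 W2
  obtain ⟨WD, SD, FD, ND, ZD, LD⟩ := fastExpansionSumZeroElim_spec hp hfl hfl2 FC2 WC2 F3 W3
  have hdef : orient2dExact tp fl a₁ a₂ b₁ b₂ c₁ c₂ =
      fastExpansionSumZeroElim fl (fastExpansionSumZeroElim fl (fastExpansionSumZeroElim fl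
        (twoTwoProdDiff tp fl (twoDiff fl a₁ c₁).1 (twoDiff fl b₂ c₂).1 (twoDiff fl a₂ c₂).1
          (twoDiff fl b₁ c₁).1)
        (twoTwoProdDiff tp fl (twoDiff fl a₁ c₁).2 (twoDiff fl b₂ c₂).1 (twoDiff fl a₂ c₂).2
          (twoDiff fl b₁ c₁).1))
        (twoTwoProdDiff tp fl (twoDiff fl a₁ c₁).1 (twoDiff fl b₂ c₂).2 (twoDiff fl a₂ c₂).1
          (twoDiff fl b₁ c₁).2))
        (twoTwoProdDiff tp fl (twoDiff fl a₁ c₁).2 (twoDiff fl b₂ c₂).2 (twoDiff fl a₂ c₂).2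
          (twoDiff fl b₁ c₁).2) := rfl
  rw [hdef]
  refine ⟨WD, ?_, FD, ND, ZD, le_trans LD (by omega)⟩
  rw [SD, SC2, SC1, SB, S1, S2, S3, orient2dDet, ← sxa, ← sya, ← sxb, ← syb]
  ring

/-- **THEOREM 7 (ORIENT2D returns the sign of the determinant).**  Under the hypotheses of Theorem 6,
`D` is nonempty and its LAST component decides the sign: `det > 0 ↔ D[last] > 0`,
`det < 0 ↔ D[last] < 0`, and `det = 0 ↔ D = ⟨0⟩` (Shewchuk's §2.8 sign and zero tests applied to the
zero-eliminated nonoverlapping expansion `D`). -/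
theorem orient2dExact_sign (hp : 4 ≤ p) (hfl : IsRoundNearest p emin fl)
    (hodd : ∀ t, fl (-t) = -fl t) (hfl2 : RoundoffBelow 2 fl) {e₀ : ℤ} (he₀ : emin ≤ e₀)
    {tp : ℚ → ℚ → ℚ × ℚ}
    (htp : ∀ x y, IsFloat p e₀ x → IsFloat p e₀ y → ExactTwoProd p emin fl tp x y)
    {a₁ a₂ b₁ b₂ c₁ c₂ : ℚ} (ha₁ : IsFloat p e₀ a₁) (ha₂ : IsFloat p e₀ a₂) (hb₁ : IsFloat p e₀ b₁)
    (hb₂ : IsFloat p e₀ b₂) (hc₁ : IsFloat p e₀ c₁) (hc₂ : IsFloat p e₀ c₂) :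
    ∃ hD : orient2dExact tp fl a₁ a₂ b₁ b₂ c₁ c₂ ≠ [],
      (0 < orient2dDet a₁ a₂ b₁ b₂ c₁ c₂ ↔
          0 < (orient2dExact tp fl a₁ a₂ b₁ b₂ c₁ c₂).getLast hD) ∧
        (orient2dDet a₁ a₂ b₁ b₂ c₁ c₂ < 0 ↔
          (orient2dExact tp fl a₁ a₂ b₁ b₂ c₁ c₂).getLast hD < 0) ∧
        (orient2dDet a₁ a₂ b₁ b₂ c₁ c₂ = 0 ↔ orient2dExact tp fl a₁ a₂ b₁ b₂ c₁ c₂ = [0]) := by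
  obtain ⟨hW, hS, hF, hne, hZ, -⟩ :=
    orient2dExact_spec hp hfl hodd hfl2 he₀ htp ha₁ ha₂ hb₁ hb₂ hc₁ hc₂
  refine ⟨hne, ?_⟩
  rw [← hS]
  rcases hZ with hnz | h0
  · obtain ⟨h1, h2, h3⟩ :=
      sign_sum_of_getLast_ne_zero hF hW.isExpansion hne (hnz _ (List.getLast_mem hne))
    refine ⟨h1, h2, ⟨fun h => absurd h h3, fun h => ?_⟩⟩
    exfalso
    rw [h] at hnz
    exact hnz 0 (List.mem_singleton_self 0) rfl
  · have key : ∀ (L : List ℚ) (h : L ≠ []), L = [0] → L.getLast h = 0 ∧ L.sum = 0 := by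
      rintro L h rfl; exact ⟨rfl, by simp⟩
    obtain ⟨hl, hs0⟩ := key _ hne h0
    rw [hl, hs0]
    exact ⟨Iff.rfl, Iff.rfl, ⟨fun _ => h0, fun _ => rfl⟩⟩

/-! ## The IEEE instance: round-to-nearest-even with an FMA two-product -/

/-- ORIENT2D's exact stage as run on a round-to-nearest-even machine with the FMA two-product
(`2Prod_FMA`), precision `p`, underflow threshold `emin`. -/
def orient2dRNE (p : ℕ) (emin : ℤ) (a₁ a₂ b₁ b₂ c₁ c₂ : ℚ) : List ℚ :=
  orient2dExact (twoProdFMA (roundTiesEven p emin)) (roundTiesEven p emin) a₁ a₂ b₁ b₂ c₁ c₂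

/-- **ORIENT2D IS CORRECT ON AN IEEE MACHINE (round-to-nearest-even, FMA two-product, `p ≥ 4`)**: for
input coordinates in `F(p, e₀)` with `emin ≤ e₀` and `emin ≤ 2e₀` (for binary64, `p = 53`,
`emin = −1074`: all six coordinates multiples of `2^−537` — no product can underflow), the computed `D`
is a weakly nonoverlapping expansion of floats with `Σ D = det` exactly, and its last component has the
sign of `det = (a₁ − c₁)(b₂ − c₂) − (a₂ − c₂)(b₁ − c₁)`, with `det = 0 ↔ D = ⟨0⟩`. -/
theorem orient2dRNE_correct (hp : 4 ≤ p) {e₀ : ℤ} (he₀ : emin ≤ e₀) (h2 : emin ≤ e₀ + e₀)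
    {a₁ a₂ b₁ b₂ c₁ c₂ : ℚ} (ha₁ : IsFloat p e₀ a₁) (ha₂ : IsFloat p e₀ a₂) (hb₁ : IsFloat p e₀ b₁)
    (hb₂ : IsFloat p e₀ b₂) (hc₁ : IsFloat p e₀ c₁) (hc₂ : IsFloat p e₀ c₂) :
    IsWeakExpansion (orient2dRNE p emin a₁ a₂ b₁ b₂ c₁ c₂) ∧
      (orient2dRNE p emin a₁ a₂ b₁ b₂ c₁ c₂).sum = orient2dDet a₁ a₂ b₁ b₂ c₁ c₂ ∧
      (∀ x ∈ orient2dRNE p emin a₁ a₂ b₁ b₂ c₁ c₂, IsFloat p emin x) ∧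
      ∃ hD : orient2dRNE p emin a₁ a₂ b₁ b₂ c₁ c₂ ≠ [],
        (0 < orient2dDet a₁ a₂ b₁ b₂ c₁ c₂ ↔ 0 < (orient2dRNE p emin a₁ a₂ b₁ b₂ c₁ c₂).getLast hD) ∧
          (orient2dDet a₁ a₂ b₁ b₂ c₁ c₂ < 0 ↔ (orient2dRNE p emin a₁ a₂ b₁ b₂ c₁ c₂).getLast hD < 0) ∧
          (orient2dDet a₁ a₂ b₁ b₂ c₁ c₂ = 0 ↔ orient2dRNE p emin a₁ a₂ b₁ b₂ c₁ c₂ = [0]) := by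
  have hp1 : 1 ≤ p := le_trans (by norm_num) hp
  have hfl : IsRoundNearest p emin (roundTiesEven p emin) := isRoundNearest_roundTiesEven hp1
  have hodd : ∀ t, roundTiesEven p emin (-t) = -roundTiesEven p emin t :=
    Literature.ComputerArithmetic.GraillatMuller2025.roundTiesEven_neg
  have hfl2 : RoundoffBelow 2 (roundTiesEven p emin) := roundoffBelow_two_roundTiesEven p emin
  have htp : ∀ x y, IsFloat p e₀ x → IsFloat p e₀ y →
      ExactTwoProd p emin (roundTiesEven p emin) (twoProdFMA (roundTiesEven p emin)) x y :=
    fun x y hx hy => exactTwoProd_twoProdFMA hp1 hfl h2 hx hy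
  obtain ⟨hW, hS, hF, -, -, -⟩ :=
    orient2dExact_spec hp hfl hodd hfl2 he₀ htp ha₁ ha₂ hb₁ hb₂ hc₁ hc₂
  exact ⟨hW, hS, hF, orient2dExact_sign hp hfl hodd hfl2 he₀ htp ha₁ ha₂ hb₁ hb₂ hc₁ hc₂⟩

/-- **ORIENT2D WITH DEKKER'S TWO-PRODUCT** (no FMA; split point `s` with `p ≤ 2s ≤ p + 1`,
round-to-nearest-even, `p ≥ 4`): the same conclusions for input coordinates in `F(p, e₀)` with
`e₀ ≥ emin + p − 1` and `2e₀ ≥ emin + 2p − 1` (the no-underflow regime of Theorem 18). -/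
theorem orient2d_dekker_correct (hp : 4 ≤ p) {s : ℕ} (hs2 : p ≤ 2 * s) (hs2' : 2 * s ≤ p + 1)
    {e₀ : ℤ} (h1 : emin + p - 1 ≤ e₀) (h2 : emin + 2 * p - 1 ≤ e₀ + e₀)
    {a₁ a₂ b₁ b₂ c₁ c₂ : ℚ} (ha₁ : IsFloat p e₀ a₁) (ha₂ : IsFloat p e₀ a₂) (hb₁ : IsFloat p e₀ b₁)
    (hb₂ : IsFloat p e₀ b₂) (hc₁ : IsFloat p e₀ c₁) (hc₂ : IsFloat p e₀ c₂) :
    let D := orient2dExact (twoProduct (roundTiesEven p emin) s) (roundTiesEven p emin)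
      a₁ a₂ b₁ b₂ c₁ c₂
    IsWeakExpansion D ∧ D.sum = orient2dDet a₁ a₂ b₁ b₂ c₁ c₂ ∧ (∀ x ∈ D, IsFloat p emin x) ∧
      ∃ hD : D ≠ [],
        (0 < orient2dDet a₁ a₂ b₁ b₂ c₁ c₂ ↔ 0 < D.getLast hD) ∧
          (orient2dDet a₁ a₂ b₁ b₂ c₁ c₂ < 0 ↔ D.getLast hD < 0) ∧
          (orient2dDet a₁ a₂ b₁ b₂ c₁ c₂ = 0 ↔ D = [0]) := by
  intro D
  have hp1 : 1 ≤ p := le_trans (by norm_num) hp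
  have he₀ : emin ≤ e₀ := by omega
  have hfl : IsRoundNearest p emin (roundTiesEven p emin) := isRoundNearest_roundTiesEven hp1
  have hodd : ∀ t, roundTiesEven p emin (-t) = -roundTiesEven p emin t :=
    Literature.ComputerArithmetic.GraillatMuller2025.roundTiesEven_neg
  have hfl2 : RoundoffBelow 2 (roundTiesEven p emin) := roundoffBelow_two_roundTiesEven p emin
  have htp : ∀ x y, IsFloat p e₀ x → IsFloat p e₀ y →
      ExactTwoProd p emin (roundTiesEven p emin) (twoProduct (roundTiesEven p emin) s) x y :=
    fun x y hx hy => exactTwoProd_twoProduct hp hs2 hs2' hfl hodd h1 h2 hx hy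
  obtain ⟨hW, hS, hF, -, -, -⟩ :=
    orient2dExact_spec hp hfl hodd hfl2 he₀ htp ha₁ ha₂ hb₁ hb₂ hc₁ hc₂
  exact ⟨hW, hS, hF, orient2dExact_sign hp hfl hodd hfl2 he₀ htp ha₁ ha₂ hb₁ hb₂ hc₁ hc₂⟩

end Summit.Ventures.CertifiedArithmetic.Expansions
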